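import Literature.MathematicalPhysics.QuantumFieldTheory.Balaban1983to89.HiggsFluctMeasureCov
import Literature.MathematicalPhysics.QuantumFieldTheory.Balaban1983to89.B1Eq243HiggsModel
import Literature.MathematicalPhysics.QuantumFieldTheory.Balaban1983to89.B3Eq15ChargeDerivative

/-!
# `Balaban1983to89.B3FluctFieldCovariance` — T. Bałaban, *(Higgs)₂,₃ quantum fields in a finite volume. III.
Renormalization*, Commun. Math. Phys. **88** (1983) 411–445 [Balaban1983Higgs3], Sect. 1 p. 414: **the fluctuation fields
`A′_j` of (1.4) are independent centred Gaussian fields with covariances `C^{(j),L^jη}`, and the field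
`A′ = A′^{(0),η} + … + A′^{(k−1),η}` of (1.1)/(1.2) has the covariance `G_k`** — PROVED for the typed objects of the lit-balaban
skeleton: the product measure `Π_{j<k} dμ_{C^{(j),L^jη}}` of `…HiggsFluctMeasure` (the measure of the typed (1.4),
`B3Eq14AuxFunction.Data14.auxE`), the maps (1.2) `A′_j ↦ A′^{(j),η} = a_j(L^jη)^{−2}G^η_jQ_j^*A′_j` of `…B3MultiscaleFields`, and the
vector-field propagator `G_k = HiggsFluctMeasure.vecG` ((I.2.20) at `N = d`, external field `0`), through the concrete
composition formula (I.2.43) of `…B1Eq243HiggsModel`; theorems only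

statement-level skeleton of published theorems with citation tags; proofs where landed; nothing here is a claim about the Yang–Mills mass gap

PDFs held: `paper:balaban1983-higgs-2-3-quantum-fields-finite-volume` (journal page = PDF page + 410) and
`paper:balaban1982-cmp85-higgs23-i` (journal page = PDF page + 602).  The sentence was read on the ×2 render
`run/shared/lean/pub/pub-balaban/b2b-balaban-ref1/pages/1983-cmp88-higgs23-III/1983-cmp88-higgs23-III-p004-x2.png` (p. 414) and
pp. 412, 612 on `…-p002-x2.png`, `…/1982-cmp85-higgs23-I/1982-cmp85-higgs23-I-p010-x2.png`, never from the OCR layer.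

CITATION HEADER (lean-in-tree rule).  lit-balaban typed skeleton (HOME `run/shared/lean/pub/lit-balaban/`), typer line,
companion of `HiggsFluctMeasure` / `HiggsFluctMeasureCov` / `B3Eq14AuxFunction`; located member of the SKELETON rows
**B3.Eq1.12-1.15** (the p. 414 paragraph «Next we have to describe propagators») and **B3.Eq1.1-1.2** (owner r15; cells
only).  THE SOURCE TEXT, p. 414 [PDF 4], verbatim: *"Next we have to describe propagators. From the formula (1.4) it follows
that A′_j are independent Gaussian fields with covariances C^{(j),L^jη}. The formulas (1.1) and (1.2) and the basic
composition formula (I.2.43) imply that the field A′ has the covariance G_k."*; p. 412 [PDF 2], (1.1)/(1.2): *"A = A′ + A^{(k)}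
= A′^{(0),η} + … + A′^{(k−1),η} + A^{(k)}, η = L^{−k}, (1.1)  A′^{(j),η} = a_j(L^jη)^{−2}G^η_jQ_j^*A′_j, j = 1, …, k − 1,
A′^{(0),η} = A′_0, (1.2)"*, and (1.4): *"Π_{j=0}^{k−1} ∫dμ_{C^{(j),L^jη}}(A′_j) …"*; paper I p. 612 [PDF 10], (2.43): *"G^ε_k(Ω,A) =
Σ_{j=1}^{k−1} a_j²(L^jε)^{−4} G^ε_j(Ω,A)Q^*_j(A)C^{(j),L^jε}(Ω,A)Q_j(A)G^ε_j(Ω,A) + C^{(0),ε}(Ω,A). (2.43)"*; paper I p. 608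
[PDF 6]: *"The renormalization transformations for vector fields will be obtained by taking N = d and an external vector
field A = 0"* and p. 617 [PDF 15]: *"The fields A′_j … are independent Gaussian random variables with the covariances
C^{(j),L^jε}. Also they are independent of the field A on the L^kε-lattice"*.

WHAT IS PROVED (0 sorry; theorems only; nothing re-declared — `fluctFamily`, `fluctMeasure`, `fluctCov`, `vecG`, `vecQ`,
`vecQAdj`, `coeff221` of `HiggsFluctMeasure`, `fluctPiece`/`fluctOp`/`toSite`/`ofSite` of `B3MultiscaleFields`,
`Data14.fluctSum` of `B3Eq14AuxFunction` consumed BY NAME).  Scalar products are (I.1.5) `HiggsLattice.siteInner`; a bond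
function `A′` is read as the `ℝ^d`-valued site function `toSite A′` (paper I p. 608); the test "sources" are bond functions
`f, g` on the `η`-lattice, `⟨A′, f⟩ := ⟨toSite A′, toSite f⟩`; the regime is the paper's `μ₀² > 0` (`msq > 0`), `a > 0`,
`L > 1`, levels `1 ≤ k ≤ K`.
* §1 bookkeeping: (1.2) is linear (typer g26 `B3Eq15ChargeDerivative.fluctPiece_add/_smul`, reused), the pairing of a sum of
  pieces is the sum of the pairings, every pairing `A′_j ↦ ⟨A′^{(j),η}, f⟩` is a continuous linear functional (`exists_clm_pairPiece`), and the
  TRANSPOSE of (1.2) for (I.1.5): `⟨A′^{(j),η}, f⟩ = ⟨A′_j, a_j(L^jη)^{−2}Q_jG^η_j f⟩` (`siteInner_toSite_fluctPiece_succ`; `Q_j^*`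
  is the adjoint of `Q_j`, `HiggsFluctMeasurePos.siteInner_vecQ_adj`; `G^η_j` is symmetric, `HiggsFluctMeasureCov.siteInner_vecG_comm`).
* §2 **«A′_j are independent Gaussian fields with covariances C^{(j),L^jη}»**: under `Π_{j<k} dμ_{C^{(j),L^jη}}` the coordinate
  fields are independent (`iIndepFun_coord`, Mathlib `iIndepFun_pi`) with marginal laws `dμ_{C^{(j),L^jη}}` (`map_eval_fluctFamily`,
  `integral_comp_eval`) — whose covariance is `C^{(j),L^jη}` by `HiggsFluctMeasureCov.integral_siteInner_mul_siteInner_fluctMeasure`;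
  hence each piece `A′^{(j),η}` is centred (`integral_pairPiece_fluctMeasure`), distinct pieces are uncorrelated
  (`integral_pairPiece_mul_pairPiece_of_ne`), and the second moments / exponential moments of one piece are those of
  `C^{(j),L^jη}` transported by (1.2) (`integral_pairPiece_mul_pairPiece_zero/succ`, `integral_exp_pairPiece`).
* §3 **«the field A′ has the covariance G_k»**: `A′ = Σ_{j<k} A′^{(j),η}` is centred (`integral_pair_fluctSum`), its covariance is
  the sum of the transported covariances (`integral_pair_fluctSum_mul_eq_sum`), that sum is `C^{(0)} + Σ_{j=1}^{k−1}
  a_j²(L^jη)^{−4}G_jQ_j^*C^{(j)}Q_jG_j` level by level and equals `G_k` by (I.2.43) for the vector field (`vecG_eq_sum243` =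
  `B1Eq243HiggsModel.display243_model` at `zeroCharge d`, `Ω = T`, `A = 0`; `sum_levels_eq_siteInner_vecG`), so
  **`∫⟨A′,f⟩⟨A′,g⟩ Π_j dμ_{C^{(j),L^jη}}(A′_j) = ⟨f, G_k g⟩`** (`integral_pair_fluctSum_mul`) and, completely characterising the law,
  **`∫ e^{⟨A′,f⟩} Π_j dμ_{C^{(j),L^jη}}(A′_j) = e^{½⟨f, G_k f⟩}`** (`integral_exp_pair_fluctSum`): `A′` IS the centred Gaussian field with
  covariance `G_k`; the same for the field `Data14.fluctSum` of the typed (1.4) (`data14_integral_fluctSum_pair_mul`,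
  `data14_integral_exp_fluctSum_pair`).
HONEST SCOPE.  `G_k` here is the vector-field propagator on the whole `η`-torus at zero background (`N = d`, `A = 0`, paper I
p. 608) — the object p. 414 names (cf. p33's `B3Ineq212VectorTorus`, p. 426 (2.12)); the second sentence of I p. 617
(*"independent of the field A on the L^kε-lattice"*) is the product structure of (1.4)/(I.3.35) itself and is not restated.
Nothing quantitative is asserted.  Unit `lit-balaban-typer` gen 30 (literature-prover-lit-balaban-typer-g30-0); HOME/FILED.md
records the proposal.
-/

open scoped BigOperators ENNReal InnerProductSpace
open _root_.MeasureTheory _root_.ProbabilityTheory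

namespace Literature.MathematicalPhysics.QuantumFieldTheory.Balaban1983to89.B3FluctFieldCovariance

open Literature.MathematicalPhysics.QuantumFieldTheory.Balaban1983to89.HiggsLattice
open Literature.MathematicalPhysics.QuantumFieldTheory.Balaban1983to89.HiggsAveraging
open Literature.MathematicalPhysics.QuantumFieldTheory.Balaban1983to89.HiggsCovariance
open Literature.MathematicalPhysics.QuantumFieldTheory.Balaban1983to89.B3MultiscaleFields
open Literature.MathematicalPhysics.QuantumFieldTheory.Balaban1983to89.HiggsFluctMeasure
open Literature.MathematicalPhysics.QuantumFieldTheory.Balaban1983to89.HiggsFluctMeasurePos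
open Literature.MathematicalPhysics.QuantumFieldTheory.Balaban1983to89.HiggsFluctMeasureCov
open Literature.MathematicalPhysics.QuantumFieldTheory.Balaban1983to89.HiggsFluctMeasureExpMoments
open Literature.MathematicalPhysics.QuantumFieldTheory.Balaban1983to89.B3Eq14AuxFunction

variable {P : HiggsLattice.Params}

/-! ## 1. Bookkeeping: (1.2) is linear; pairings; the transpose of (1.2) for the scalar products (I.1.5) -/

section Bookkeeping

/-- `toSite` of a finite sum of bond functions is the sum (re-indexing). [cite: Balaban1982Higgs1, p.608] -/
theorem toSite_sum {j : ℕ} {ι : Type*} (s : Finset ι) (A : ι → HiggsLattice.VecField P j) :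
    toSite (∑ i ∈ s, A i) = ∑ i ∈ s, toSite (A i) := by
  classical
  induction s using Finset.induction_on with
  | empty =>
      simp only [Finset.sum_empty]
      funext x
      ext μ
      simp [toSite]
  | insert i s hi ih => rw [Finset.sum_insert hi, Finset.sum_insert hi, toSite_add, ih]

/-- (I.1.5) is additive in the first argument. [cite: Balaban1982Higgs1, (1.5) p.604] -/
theorem siteInner_add_left {j M : ℕ} (f g h : ScalarField P j M) : siteInner (f + g) h = siteInner f h + siteInner g h := by
  rw [siteInner_comm, siteInner_add_right, siteInner_comm h f, siteInner_comm h g]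

/-- (I.1.5) of a finite sum in the first argument. [cite: Balaban1982Higgs1, (1.5) p.604] -/
theorem siteInner_sum_left {j M : ℕ} {ι : Type*} (s : Finset ι) (f : ι → ScalarField P j M) (h : ScalarField P j M) :
    siteInner (∑ i ∈ s, f i) h = ∑ i ∈ s, siteInner (f i) h := by
  classical
  induction s using Finset.induction_on with
  | empty => rw [Finset.sum_empty, Finset.sum_empty, siteInner_comm, siteInner_zero_right]
  | insert i s hi ih => rw [Finset.sum_insert hi, Finset.sum_insert hi, siteInner_add_left, ih]

/-- (I.1.5) of a finite sum in the second argument. [cite: Balaban1982Higgs1, (1.5) p.604] -/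
theorem siteInner_sum_right {j M : ℕ} {ι : Type*} (s : Finset ι) (f : ScalarField P j M) (g : ι → ScalarField P j M) :
    siteInner f (∑ i ∈ s, g i) = ∑ i ∈ s, siteInner f (g i) := by
  rw [siteInner_comm, siteInner_sum_left]
  exact Finset.sum_congr rfl fun i _ => siteInner_comm _ _

/-- The operator of (1.2) in the vocabulary of `HiggsFluctMeasure`: `a_j(L^jη)^{−2}·G^η_j(Q_j^* g)` with `a_j(L^jη)^{−2}` =
`coeff221`, `G^η_j` = `vecG`, `Q_j^*` = `vecQAdj` (same objects, by definition). [cite: Balaban1983Higgs3, (1.2) p.412] -/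
theorem fluctOp_eq_vec (msq a : ℝ) (j : ℕ) (g : ScalarField P j P.d) :
    fluctOp msq a j g = coeff221 P a j • vecG P msq a j (vecQAdj P j g) := by
  rw [fluctOp_eq, coeff221_eq, inv_pow]
  rfl

/-- (1.2) for `j ≥ 1`, read as an `ℝ^d`-valued site function: `A′^{(j),η} = a_j(L^jη)^{−2}G^η_jQ_j^*A′_j`. [cite: Balaban1983Higgs3, (1.2) p.412] -/
theorem toSite_fluctPiece_succ (msq a : ℝ) (j : ℕ) (A : HiggsLattice.VecField P (j + 1)) :
    toSite (fluctPiece msq a (j + 1) A) = coeff221 P a (j + 1) • vecG P msq a (j + 1) (vecQAdj P (j + 1) (toSite A)) := by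
  rw [fluctPiece_succ, toSite_ofSite, fluctOp_eq_vec]

/-- **The transpose of (1.2) for the scalar products (I.1.5) of the two lattices**, `j ≥ 1`:
`⟨A′^{(j),η}, u⟩_η = ⟨A′_j, a_j(L^jη)^{−2}Q_jG^η_j u⟩_{L^jη}` (`Q_j^*` is the adjoint of `Q_j`, (I.2.20); `G^η_j` is symmetric).
[cite: Balaban1983Higgs3, (1.2) p.412] -/
theorem siteInner_toSite_fluctPiece_succ (msq a : ℝ) (j : ℕ) (A : HiggsLattice.VecField P (j + 1)) (u : ScalarField P 0 P.d) :
    siteInner (toSite (fluctPiece msq a (j + 1) A)) u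
      = siteInner (toSite A) (coeff221 P a (j + 1) • vecQ P (j + 1) (vecG P msq a (j + 1) u)) := by
  rw [toSite_fluctPiece_succ, siteInner_smul_left, siteInner_smul_right]
  congr 1
  rw [siteInner_comm _ u, siteInner_vecG_comm, siteInner_comm _ (vecG P msq a (j + 1) u), ← siteInner_vecQ_adj,
    siteInner_comm _ (toSite A)]

/-- (1.2) at `j = 0` is the identity: `⟨A′^{(0),η}, u⟩ = ⟨A′_0, u⟩`. [cite: Balaban1983Higgs3, (1.2) p.412] -/
theorem siteInner_toSite_fluctPiece_zero (msq a : ℝ) (A : HiggsLattice.VecField P 0) (u : ScalarField P 0 P.d) :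
    siteInner (toSite (fluctPiece msq a 0 A)) u = siteInner (toSite A) u := rfl

/-- The pairing `⟨Σ_j A′^{(j),η}, u⟩` of a sum of pieces is the sum of the pairings ((1.1) is a sum; (I.1.5) is bilinear).
[cite: Balaban1983Higgs3, (1.1) p.412] -/
theorem siteInner_toSite_sum_left {j : ℕ} {ι : Type*} (s : Finset ι) (A : ι → HiggsLattice.VecField P j) (u : ScalarField P j P.d) :
    siteInner (toSite (∑ i ∈ s, A i)) u = ∑ i ∈ s, siteInner (toSite (A i)) u := by
  rw [toSite_sum, siteInner_sum_left]

/-- **Every pairing `A′_j ↦ ⟨A′^{(j),η}, u⟩` is a continuous linear functional** of the fluctuation field (finite lattice).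
[cite: Balaban1983Higgs3, (1.2) p.412] -/
theorem exists_clm_pairPiece (msq a : ℝ) (j : ℕ) (u : ScalarField P 0 P.d) :
    ∃ L : HiggsLattice.VecField P j →L[ℝ] ℝ, ∀ A, L A = siteInner (toSite (fluctPiece msq a j A)) u := by
  let ℓ : HiggsLattice.VecField P j →ₗ[ℝ] ℝ :=
    { toFun := fun A => siteInner (toSite (fluctPiece msq a j A)) u
      map_add' := fun A B => by
        simp only [B3Eq15ChargeDerivative.fluctPiece_add, toSite_add, siteInner_add_left]
      map_smul' := fun c A => by
        simp only [B3Eq15ChargeDerivative.fluctPiece_smul, toSite_smul, siteInner_smul_left, RingHom.id_apply,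
          smul_eq_mul] }
  exact ⟨LinearMap.toContinuousLinearMap ℓ, fun A => rfl⟩

end Bookkeeping

/-! ## 2. «A′_j are independent Gaussian fields with covariances C^{(j),L^jη}» (p. 414) -/

section Independent

variable {msq a : ℝ}

/-- Each factor `dμ_{C^{(j),L^jη}}`, `j < k ≤ K`, of the product measure of (1.4) is a probability measure (instance form of
`HiggsFluctMeasurePos.fluctMeasure_isProbability`). [cite: Balaban1983Higgs3, (1.4) p.412] -/
theorem isProbabilityMeasure_factor (hmsq : 0 < msq) (ha : 0 < a) (hL : 1 < (P.L : ℝ)) {k : ℕ} (hk : k ≤ P.K)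
    (j : Fin k) : IsProbabilityMeasure (fluctMeasure P msq a j) :=
  fluctMeasure_isProbability hmsq ha hL ((Nat.le_of_lt j.isLt).trans hk)

/-- **«A′_j are independent»**: under `Π_{j<k} dμ_{C^{(j),L^jη}}` (the measure of (1.4)) the coordinate fields
`(A′_l)_{l<k} ↦ A′_j` are (mutually) independent random variables — paper I p. 617: *"The fields A′_j … are independent
Gaussian random variables"*. PROVED (`Measure.pi`). [cite: Balaban1983Higgs3, §1 p.414] -/
theorem iIndepFun_coord (hmsq : 0 < msq) (ha : 0 < a) (hL : 1 < (P.L : ℝ)) {k : ℕ} (hk : k ≤ P.K) :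
    iIndepFun (fun (j : Fin k) (F : (l : Fin k) → HiggsLattice.VecField P l) => F j) (fluctFamily P msq a k) := by
  haveI := isProbabilityMeasure_factor hmsq ha hL hk
  rw [fluctFamily_eq]
  exact iIndepFun_pi (X := fun j : Fin k => (id : HiggsLattice.VecField P j → HiggsLattice.VecField P j)) fun _ => aemeasurable_id

/-- **The law of `A′_j` under the product measure is `dμ_{C^{(j),L^jη}}`** (the `j`-th marginal of `Π_l dμ_{C^{(l)}}`).
[cite: Balaban1983Higgs3, §1 p.414] -/
theorem map_eval_fluctFamily (hmsq : 0 < msq) (ha : 0 < a) (hL : 1 < (P.L : ℝ)) {k : ℕ} (hk : k ≤ P.K) (j : Fin k) :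
    (fluctFamily P msq a k).map (fun F : (l : Fin k) → HiggsLattice.VecField P l => F j) = fluctMeasure P msq a j := by
  haveI := isProbabilityMeasure_factor hmsq ha hL hk
  rw [fluctFamily_eq]
  exact (measurePreserving_eval (fun l : Fin k => fluctMeasure P msq a l) j).map_eq

/-- Integrating a (continuous) function of the single field `A′_j` against the product measure is integrating it against
`dμ_{C^{(j),L^jη}}`. [cite: Balaban1983Higgs3, §1 p.414] -/
theorem integral_comp_eval (hmsq : 0 < msq) (ha : 0 < a) (hL : 1 < (P.L : ℝ)) {k : ℕ} (hk : k ≤ P.K) (j : Fin k)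
    {φ : HiggsLattice.VecField P j → ℝ} (hφ : Continuous φ) :
    ∫ F, φ (F j) ∂(fluctFamily P msq a k) = ∫ A, φ A ∂(fluctMeasure P msq a j) := by
  rw [← map_eval_fluctFamily hmsq ha hL hk j,
    integral_map (measurable_pi_apply j).aemeasurable hφ.aestronglyMeasurable]

/-- **«Gaussian … with covariances C^{(j),L^jη}», transported by (1.2): each piece `A′^{(j),η}` is CENTRED**,
`∫⟨A′^{(j),η}, u⟩ dμ_{C^{(j),L^jη}}(A′_j) = 0` (every `j`, every test site function `u` on the `η`-lattice; unconditional).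
[cite: Balaban1983Higgs3, §1 p.414] -/
theorem integral_pairPiece_fluctMeasure (msq a : ℝ) : ∀ (j : ℕ) (u : ScalarField P 0 P.d),
    ∫ A, siteInner (toSite (fluctPiece msq a j A)) u ∂(fluctMeasure P msq a j) = 0
  | 0, u => by
      have h := integral_siteInner_fluctMeasure msq a 0 (ofSite u)
      rwa [toSite_ofSite] at h
  | j + 1, u => by
      simp only [siteInner_toSite_fluctPiece_succ]
      have h := integral_siteInner_fluctMeasure msq a (j + 1)
        (ofSite (coeff221 P a (j + 1) • vecQ P (j + 1) (vecG P msq a (j + 1) u)))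
      rwa [toSite_ofSite] at h

/-- The transported covariance at level `0`: `∫⟨A′^{(0),η},f⟩⟨A′^{(0),η},g⟩ dμ_{C^{(0),η}} = ⟨f, C^{(0),η} g⟩` ((1.2): `A′^{(0),η} = A′_0`).
[cite: Balaban1983Higgs3, §1 p.414] -/
theorem integral_pairPiece_mul_pairPiece_zero (hmsq : 0 < msq) (ha : 0 < a) (hL : 1 < (P.L : ℝ)) (f g : HiggsLattice.VecField P 0) :
    ∫ A, siteInner (toSite (fluctPiece msq a 0 A)) (toSite f) * siteInner (toSite (fluctPiece msq a 0 A)) (toSite g)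
        ∂(fluctMeasure P msq a 0)
      = siteInner (toSite f) (fluctCov P msq a 0 (toSite g)) :=
  integral_siteInner_mul_siteInner_fluctMeasure hmsq ha hL (Nat.zero_le _) f g

/-- The algebra of the transported covariance at level `j ≥ 1`: `⟨T_j^†f, C^{(j)}T_j^†g⟩ = a_j²(L^jη)^{−4}⟨f, G_jQ_j^*C^{(j)}Q_jG_j g⟩`
with `T_j^† = a_j(L^jη)^{−2}Q_jG_j` the transpose of (1.2) — the summand of (I.2.43). [cite: Balaban1982Higgs1, (2.43) p.612] -/
theorem siteInner_transpose_fluctCov_transpose (msq a : ℝ) (j : ℕ) (f g : ScalarField P 0 P.d) :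
    siteInner (coeff221 P a j • vecQ P j (vecG P msq a j f)) (fluctCov P msq a j (coeff221 P a j • vecQ P j (vecG P msq a j g)))
      = coeff221 P a j ^ 2
        * siteInner f ((vecG P msq a j ∘ₗ vecQAdj P j ∘ₗ fluctCov P msq a j ∘ₗ vecQ P j ∘ₗ vecG P msq a j) g) := by
  rw [map_smul, siteInner_smul_left, siteInner_smul_right, siteInner_vecQ_adj,
    siteInner_comm (vecG P msq a j f), siteInner_vecG_comm]
  simp only [LinearMap.comp_apply]
  ring

/-- **The transported covariance at level `j ≥ 1`** (`j ≤ K`): `∫⟨A′^{(j),η},f⟩⟨A′^{(j),η},g⟩ dμ_{C^{(j),L^jη}}(A′_j) =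
a_j²(L^jη)^{−4}⟨f, G^η_jQ_j^*C^{(j),L^jη}Q_jG^η_j g⟩` — the `j`-th summand of (I.2.43). [cite: Balaban1983Higgs3, §1 p.414] -/
theorem integral_pairPiece_mul_pairPiece_succ (hmsq : 0 < msq) (ha : 0 < a) (hL : 1 < (P.L : ℝ)) {j : ℕ}
    (hj : j + 1 ≤ P.K) (f g : HiggsLattice.VecField P 0) :
    ∫ A, siteInner (toSite (fluctPiece msq a (j + 1) A)) (toSite f)
          * siteInner (toSite (fluctPiece msq a (j + 1) A)) (toSite g) ∂(fluctMeasure P msq a (j + 1))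
      = coeff221 P a (j + 1) ^ 2 * siteInner (toSite f)
          ((vecG P msq a (j + 1) ∘ₗ vecQAdj P (j + 1) ∘ₗ fluctCov P msq a (j + 1) ∘ₗ vecQ P (j + 1)
            ∘ₗ vecG P msq a (j + 1)) (toSite g)) := by
  simp only [siteInner_toSite_fluctPiece_succ]
  have h := integral_siteInner_mul_siteInner_fluctMeasure hmsq ha hL hj
    (ofSite (coeff221 P a (j + 1) • vecQ P (j + 1) (vecG P msq a (j + 1) (toSite f))))
    (ofSite (coeff221 P a (j + 1) • vecQ P (j + 1) (vecG P msq a (j + 1) (toSite g))))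
  simp only [toSite_ofSite] at h
  rw [h, siteInner_transpose_fluctCov_transpose]

/-- **Distinct pieces are uncorrelated**: for `j ≠ i`, `∫⟨A′^{(j),η},u⟩⟨A′^{(i),η},v⟩ Π_l dμ_{C^{(l),L^lη}}(A′_l) = 0`
(independence and centredness). [cite: Balaban1983Higgs3, §1 p.414] -/
theorem integral_pairPiece_mul_pairPiece_of_ne (hmsq : 0 < msq) (ha : 0 < a) (hL : 1 < (P.L : ℝ)) {k : ℕ} (hk : k ≤ P.K)
    {j i : Fin k} (hji : j ≠ i) (u v : ScalarField P 0 P.d) :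
    ∫ F, siteInner (toSite (fluctPiece msq a j (F j))) u * siteInner (toSite (fluctPiece msq a i (F i))) v
        ∂(fluctFamily P msq a k) = 0 := by
  obtain ⟨L, hL'⟩ := exists_clm_pairPiece (P := P) msq a j u
  obtain ⟨L', hL''⟩ := exists_clm_pairPiece (P := P) msq a i v
  have hind : IndepFun (L ∘ fun F : (l : Fin k) → HiggsLattice.VecField P l => F j)
      (L' ∘ fun F : (l : Fin k) → HiggsLattice.VecField P l => F i) (fluctFamily P msq a k) :=
    ((iIndepFun_coord hmsq ha hL hk).indepFun hji).comp L.continuous.measurable L'.continuous.measurable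
  have h := hind.integral_fun_mul_eq_mul_integral
    (L.continuous.comp (continuous_apply j)).aestronglyMeasurable
    (L'.continuous.comp (continuous_apply i)).aestronglyMeasurable
  simp only [Function.comp_apply] at h
  simp only [← hL', ← hL'']
  rw [h]
  have h0 : ∫ F, L (F j) ∂(fluctFamily P msq a k) = 0 := by
    rw [integral_comp_eval hmsq ha hL hk j L.continuous]
    simp only [hL']
    exact integral_pairPiece_fluctMeasure msq a j u
  rw [h0, zero_mul]

/-- **The same piece twice**: `∫⟨A′^{(j),η},u⟩⟨A′^{(j),η},v⟩ Π_l dμ_{C^{(l),L^lη}}(A′_l) = ∫⟨A′^{(j),η},u⟩⟨A′^{(j),η},v⟩ dμ_{C^{(j),L^jη}}(A′_j)`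
(marginal). [cite: Balaban1983Higgs3, §1 p.414] -/
theorem integral_pairPiece_mul_pairPiece_same (hmsq : 0 < msq) (ha : 0 < a) (hL : 1 < (P.L : ℝ)) {k : ℕ} (hk : k ≤ P.K)
    (j : Fin k) (u v : ScalarField P 0 P.d) :
    ∫ F, siteInner (toSite (fluctPiece msq a j (F j))) u * siteInner (toSite (fluctPiece msq a j (F j))) v
        ∂(fluctFamily P msq a k)
      = ∫ A, siteInner (toSite (fluctPiece msq a j A)) u * siteInner (toSite (fluctPiece msq a j A)) v
        ∂(fluctMeasure P msq a j) := by
  obtain ⟨L, hL'⟩ := exists_clm_pairPiece (P := P) msq a j u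
  obtain ⟨L', hL''⟩ := exists_clm_pairPiece (P := P) msq a j v
  simp only [← hL', ← hL'']
  exact integral_comp_eval hmsq ha hL hk j (L.continuous.mul L'.continuous)

/-- Products of two pairings of pieces are integrable against the product measure (linear functionals of Gaussian fields;
polynomial moments `HiggsFluctMeasureExpMoments.integrable_of_polyGrowth_fluctFamily`). [cite: Balaban1983Higgs3, §1 p.414] -/
theorem integrable_pairPiece_mul_pairPiece (hmsq : 0 < msq) (ha : 0 < a) (hL : 1 < (P.L : ℝ)) {k : ℕ} (hk : k ≤ P.K)
    (j i : Fin k) (u v : ScalarField P 0 P.d) :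
    Integrable (fun F : (l : Fin k) → HiggsLattice.VecField P l =>
      siteInner (toSite (fluctPiece msq a j (F j))) u * siteInner (toSite (fluctPiece msq a i (F i))) v)
      (fluctFamily P msq a k) := by
  obtain ⟨L, hL'⟩ := exists_clm_pairPiece (P := P) msq a j u
  obtain ⟨L', hL''⟩ := exists_clm_pairPiece (P := P) msq a i v
  simp only [← hL', ← hL'']
  refine integrable_of_polyGrowth_fluctFamily hmsq ha hL hk
    ((L.continuous.comp (continuous_apply j)).mul (L'.continuous.comp (continuous_apply i))).aestronglyMeasurable
    (C := ‖L‖ * ‖L'‖) (p := 2) fun F => ?_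
  have h1 : |L (F j)| ≤ ‖L‖ * ‖F‖ :=
    (Real.norm_eq_abs _ ▸ L.le_opNorm (F j)).trans (mul_le_mul_of_nonneg_left (norm_le_pi_norm F j) (norm_nonneg _))
  have h2 : |L' (F i)| ≤ ‖L'‖ * ‖F‖ :=
    (Real.norm_eq_abs _ ▸ L'.le_opNorm (F i)).trans (mul_le_mul_of_nonneg_left (norm_le_pi_norm F i) (norm_nonneg _))
  have hF : ‖F‖ ^ 2 ≤ (1 + ‖F‖) ^ 2 := by nlinarith [norm_nonneg F]
  rw [abs_mul]
  calc |L (F j)| * |L' (F i)| ≤ (‖L‖ * ‖F‖) * (‖L'‖ * ‖F‖) := mul_le_mul h1 h2 (abs_nonneg _) (by positivity)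
    _ = ‖L‖ * ‖L'‖ * ‖F‖ ^ 2 := by ring
    _ ≤ ‖L‖ * ‖L'‖ * (1 + ‖F‖) ^ 2 := mul_le_mul_of_nonneg_left hF (by positivity)

/-- **Exponential moments of one piece**: `∫ e^{⟨A′^{(j),η},f⟩} dμ_{C^{(j),L^jη}}(A′_j) = exp(½·∫⟨A′^{(j),η},f⟩² dμ_{C^{(j),L^jη}})` —
the transported law is the centred Gaussian with the transported covariance (`HiggsFluctMeasureCov.integral_exp_siteInner_fluctMeasure`),
`j ≤ K`. [cite: Balaban1983Higgs3, §1 p.414] -/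
theorem integral_exp_pairPiece (hmsq : 0 < msq) (ha : 0 < a) (hL : 1 < (P.L : ℝ)) :
    ∀ {j : ℕ}, j ≤ P.K → ∀ f : HiggsLattice.VecField P 0,
      ∫ A, Real.exp (siteInner (toSite (fluctPiece msq a j A)) (toSite f)) ∂(fluctMeasure P msq a j)
        = Real.exp ((1 / 2) * ∫ A, siteInner (toSite (fluctPiece msq a j A)) (toSite f)
            * siteInner (toSite (fluctPiece msq a j A)) (toSite f) ∂(fluctMeasure P msq a j))
  | 0, hj, f => by
      rw [integral_pairPiece_mul_pairPiece_zero hmsq ha hL]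
      exact integral_exp_siteInner_fluctMeasure hmsq ha hL hj f
  | j + 1, hj, f => by
      rw [integral_pairPiece_mul_pairPiece_succ hmsq ha hL hj]
      simp only [siteInner_toSite_fluctPiece_succ]
      have h := integral_exp_siteInner_fluctMeasure hmsq ha hL hj
        (ofSite (coeff221 P a (j + 1) • vecQ P (j + 1) (vecG P msq a (j + 1) (toSite f))))
      simp only [toSite_ofSite] at h
      rw [h, siteInner_transpose_fluctCov_transpose]

end Independent

/-! ## 3. «the field A′ has the covariance G_k» (p. 414) -/

section FieldCovariance

variable {msq a : ℝ}

/-- **(I.2.43) for the vector field** (`N = d`, external field `0`, whole torus — paper I p. 608), `1 ≤ k ≤ K`, `msq > 0`,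
`a > 0`, `L > 1`: `G_k = Σ_{j=1}^{k−1} a_j²(L^jη)^{−4}G^η_jQ_j^*C^{(j),L^jη}Q_jG^η_j + C^{(0),η}` — p35's concrete
`B1Eq243HiggsModel.display243_model` at the trivial coupling, BY NAME (`B1Eq230FluctCov.fluctCovA_zero_field`).
[cite: Balaban1982Higgs1, (2.43) p.612] -/
theorem vecG_eq_sum243 (hmsq : 0 < msq) (ha : 0 < a) (hL : 1 < (P.L : ℝ)) {k : ℕ} (hk : 1 ≤ k) (hkK : k ≤ P.K) :
    vecG P msq a k
      = (∑ j ∈ Finset.Ico 1 k, (coeff221 P a j ^ 2) •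
          (vecG P msq a j ∘ₗ vecQAdj P j ∘ₗ fluctCov P msq a j ∘ₗ vecQ P j ∘ₗ vecG P msq a j))
        + fluctCov P msq a 0 := by
  have h := B1Eq243HiggsModel.display243_model (zeroCharge P.d) Finset.univ (0 : HiggsLattice.VecField P 0) hmsq ha hL hk hkK
  simp only [B1Eq230FluctCov.fluctCovA_zero_field] at h
  exact h

/-- **The transported covariances sum to `G_k`**: `Σ_{j<k} ∫⟨A′^{(j),η},f⟩⟨A′^{(j),η},g⟩ dμ_{C^{(j),L^jη}}(A′_j) = ⟨f, G_k g⟩` —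
level `0` gives `C^{(0),η}`, level `j ≥ 1` gives the `j`-th summand of (I.2.43) (*"The formulas (1.1) and (1.2) and the basic
composition formula (I.2.43) imply …"*). [cite: Balaban1983Higgs3, §1 p.414] -/
theorem sum_levels_eq_siteInner_vecG (hmsq : 0 < msq) (ha : 0 < a) (hL : 1 < (P.L : ℝ)) {k : ℕ} (hk : 1 ≤ k)
    (hkK : k ≤ P.K) (f g : HiggsLattice.VecField P 0) :
    ∑ j : Fin k, ∫ A, siteInner (toSite (fluctPiece msq a j A)) (toSite f)
        * siteInner (toSite (fluctPiece msq a j A)) (toSite g) ∂(fluctMeasure P msq a j)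
      = siteInner (toSite f) (vecG P msq a k (toSite g)) := by
  obtain ⟨k', rfl⟩ : ∃ k', k = k' + 1 := ⟨k - 1, by omega⟩
  rw [Fin.sum_univ_eq_sum_range (n := k' + 1) (f := fun m => ∫ A, siteInner (toSite (fluctPiece msq a m A)) (toSite f)
      * siteInner (toSite (fluctPiece msq a m A)) (toSite g) ∂(fluctMeasure P msq a m)),
    Finset.sum_range_succ', integral_pairPiece_mul_pairPiece_zero hmsq ha hL,
    vecG_eq_sum243 hmsq ha hL hk hkK, LinearMap.add_apply, siteInner_add_right, LinearMap.sum_apply,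
    siteInner_sum_right, Finset.sum_Ico_eq_sum_range, Nat.add_sub_cancel]
  congr 1
  refine Finset.sum_congr rfl fun m hm => ?_
  have hmK : m + 1 ≤ P.K := by
    have := Finset.mem_range.mp hm
    omega
  rw [integral_pairPiece_mul_pairPiece_succ hmsq ha hL hmK, Nat.add_comm 1 m, LinearMap.smul_apply,
    siteInner_smul_right]

/-- **`A′` is centred**: `∫⟨A′, f⟩ Π_j dμ_{C^{(j),L^jη}}(A′_j) = 0` for `A′ = Σ_{j<k} A′^{(j),η}` ((1.1)), `k ≤ K`.
[cite: Balaban1983Higgs3, §1 p.414] -/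
theorem integral_pair_fluctSum (hmsq : 0 < msq) (ha : 0 < a) (hL : 1 < (P.L : ℝ)) {k : ℕ} (hk : k ≤ P.K)
    (f : HiggsLattice.VecField P 0) :
    ∫ F, siteInner (toSite (∑ j : Fin k, fluctPiece msq a j (F j))) (toSite f) ∂(fluctFamily P msq a k) = 0 := by
  simp only [siteInner_toSite_sum_left]
  rw [integral_finsetSum _ fun j _ => ?_]
  · refine Finset.sum_eq_zero fun j _ => ?_
    obtain ⟨L, hL'⟩ := exists_clm_pairPiece (P := P) msq a j (toSite f)
    simp only [← hL']
    rw [integral_comp_eval hmsq ha hL hk j L.continuous]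
    simp only [hL']
    exact integral_pairPiece_fluctMeasure msq a j (toSite f)
  · obtain ⟨L, hL'⟩ := exists_clm_pairPiece (P := P) msq a j (toSite f)
    simp only [← hL']
    haveI := isProbabilityMeasure_factor hmsq ha hL hk
    haveI := fluctFamily_isProbability (P := P) hmsq ha hL hk
    refine integrable_of_polyGrowth_fluctFamily hmsq ha hL hk (L.continuous.comp (continuous_apply j)).aestronglyMeasurable
      (C := ‖L‖) (p := 1) fun F => ?_
    rw [pow_one]
    calc |L (F j)| ≤ ‖L‖ * ‖F j‖ := Real.norm_eq_abs _ ▸ L.le_opNorm (F j)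
      _ ≤ ‖L‖ * ‖F‖ := mul_le_mul_of_nonneg_left (norm_le_pi_norm F j) (norm_nonneg _)
      _ ≤ ‖L‖ * (1 + ‖F‖) := mul_le_mul_of_nonneg_left (by linarith [norm_nonneg F]) (norm_nonneg _)

/-- **The covariance of `A′` is the sum of the transported covariances** (independence kills the cross terms):
`∫⟨A′,f⟩⟨A′,g⟩ Π_j dμ_{C^{(j),L^jη}}(A′_j) = Σ_{j<k} ∫⟨A′^{(j),η},f⟩⟨A′^{(j),η},g⟩ dμ_{C^{(j),L^jη}}(A′_j)`, `k ≤ K`.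
[cite: Balaban1983Higgs3, §1 p.414] -/
theorem integral_pair_fluctSum_mul_eq_sum (hmsq : 0 < msq) (ha : 0 < a) (hL : 1 < (P.L : ℝ)) {k : ℕ} (hk : k ≤ P.K)
    (f g : HiggsLattice.VecField P 0) :
    ∫ F, siteInner (toSite (∑ j : Fin k, fluctPiece msq a j (F j))) (toSite f)
        * siteInner (toSite (∑ j : Fin k, fluctPiece msq a j (F j))) (toSite g) ∂(fluctFamily P msq a k)
      = ∑ j : Fin k, ∫ A, siteInner (toSite (fluctPiece msq a j A)) (toSite f)
        * siteInner (toSite (fluctPiece msq a j A)) (toSite g) ∂(fluctMeasure P msq a j) := by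
  simp only [siteInner_toSite_sum_left, Finset.sum_mul_sum]
  rw [integral_finsetSum _ fun j _ =>
    integrable_finsetSum _ fun i _ => integrable_pairPiece_mul_pairPiece hmsq ha hL hk j i (toSite f) (toSite g)]
  refine Finset.sum_congr rfl fun j _ => ?_
  rw [integral_finsetSum _ fun i _ => integrable_pairPiece_mul_pairPiece hmsq ha hL hk j i (toSite f) (toSite g),
    Finset.sum_eq_single j (fun i _ hij => integral_pairPiece_mul_pairPiece_of_ne hmsq ha hL hk (Ne.symm hij) _ _)
      (fun h => (h (Finset.mem_univ j)).elim),
    integral_pairPiece_mul_pairPiece_same hmsq ha hL hk j]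

/-- **«the field A′ has the covariance G_k»** (p. 414): for `A′ = A′^{(0),η} + … + A′^{(k−1),η}` ((1.1)/(1.2)) under the measure
`Π_{j<k} dμ_{C^{(j),L^jη}}(A′_j)` of (1.4), and all bond functions `f, g` on the `η`-lattice,
`∫⟨A′, f⟩⟨A′, g⟩ Π_j dμ_{C^{(j),L^jη}}(A′_j) = ⟨f, G_k g⟩` with `G_k` the vector-field propagator (`N = d`, `A = 0`) — by (1.1),
(1.2) and (I.2.43), as print says; `msq > 0`, `a > 0`, `L > 1`, `1 ≤ k ≤ K`. PROVED. [cite: Balaban1983Higgs3, §1 p.414] -/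
theorem integral_pair_fluctSum_mul (hmsq : 0 < msq) (ha : 0 < a) (hL : 1 < (P.L : ℝ)) {k : ℕ} (hk : 1 ≤ k) (hkK : k ≤ P.K)
    (f g : HiggsLattice.VecField P 0) :
    ∫ F, siteInner (toSite (∑ j : Fin k, fluctPiece msq a j (F j))) (toSite f)
        * siteInner (toSite (∑ j : Fin k, fluctPiece msq a j (F j))) (toSite g) ∂(fluctFamily P msq a k)
      = siteInner (toSite f) (vecG P msq a k (toSite g)) := by
  rw [integral_pair_fluctSum_mul_eq_sum hmsq ha hL hkK, sum_levels_eq_siteInner_vecG hmsq ha hL hk hkK]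

/-- **`A′` IS the centred Gaussian field with covariance `G_k`** (moment generating function):
`∫ e^{⟨A′, f⟩} Π_j dμ_{C^{(j),L^jη}}(A′_j) = e^{½⟨f, G_k f⟩}`, `1 ≤ k ≤ K` (independence: the integral factorises over the levels;
each factor is the Gaussian exponential moment of `C^{(j),L^jη}` transported by (1.2); the exponents sum to `½⟨f,G_kf⟩` by (I.2.43)).
PROVED. [cite: Balaban1983Higgs3, §1 p.414] -/
theorem integral_exp_pair_fluctSum (hmsq : 0 < msq) (ha : 0 < a) (hL : 1 < (P.L : ℝ)) {k : ℕ} (hk : 1 ≤ k) (hkK : k ≤ P.K)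
    (f : HiggsLattice.VecField P 0) :
    ∫ F, Real.exp (siteInner (toSite (∑ j : Fin k, fluctPiece msq a j (F j))) (toSite f)) ∂(fluctFamily P msq a k)
      = Real.exp ((1 / 2) * siteInner (toSite f) (vecG P msq a k (toSite f))) := by
  haveI := isProbabilityMeasure_factor hmsq ha hL hkK
  simp only [siteInner_toSite_sum_left, Real.exp_sum]
  rw [fluctFamily_eq, integral_fintype_prod_eq_prod
    (E := fun l : Fin k => HiggsLattice.VecField P l)
    (f := fun (l : Fin k) (A : HiggsLattice.VecField P l) => Real.exp (siteInner (toSite (fluctPiece msq a l A)) (toSite f)))]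
  rw [← sum_levels_eq_siteInner_vecG hmsq ha hL hk hkK f f, Finset.mul_sum, Real.exp_sum]
  exact Finset.prod_congr rfl fun j _ =>
    integral_exp_pairPiece hmsq ha hL ((Nat.le_of_lt j.isLt).trans hkK) f

/-! ### The same for the field `A′` of the typed (1.4) (`B3Eq14AuxFunction.Data14.fluctSum`) -/

/-- For the data of (1.4): `∫⟨A′, f⟩ Π_j dμ_{C^{(j),L^jη}}(A′_j) = 0` with `A′ = Data14.fluctSum` and the vector mass / precision
of the data (`k ≤ K`). [cite: Balaban1983Higgs3, §1 p.414] -/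
theorem data14_integral_fluctSum_pair {N k : ℕ} (D : Data14 P N k) (hmsq : 0 < D.msq) (ha : 0 < D.a)
    (hL : 1 < (P.L : ℝ)) (hk : k ≤ P.K) (f : HiggsLattice.VecField P 0) :
    ∫ F, siteInner (toSite (D.fluctSum F)) (toSite f) ∂(fluctFamily P D.msq D.a k) = 0 :=
  integral_pair_fluctSum hmsq ha hL hk f

/-- **For the data of (1.4): the field `A′ = Data14.fluctSum` entering `e′g_kA′ + A^{(k)}` has the covariance `G_k`**:
`∫⟨A′,f⟩⟨A′,g⟩ Π_j dμ_{C^{(j),L^jη}}(A′_j) = ⟨f, G_k g⟩`, `1 ≤ k ≤ K`. [cite: Balaban1983Higgs3, §1 p.414] -/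
theorem data14_integral_fluctSum_pair_mul {N k : ℕ} (D : Data14 P N k) (hmsq : 0 < D.msq) (ha : 0 < D.a)
    (hL : 1 < (P.L : ℝ)) (hk : 1 ≤ k) (hkK : k ≤ P.K) (f g : HiggsLattice.VecField P 0) :
    ∫ F, siteInner (toSite (D.fluctSum F)) (toSite f) * siteInner (toSite (D.fluctSum F)) (toSite g)
        ∂(fluctFamily P D.msq D.a k)
      = siteInner (toSite f) (vecG P D.msq D.a k (toSite g)) :=
  integral_pair_fluctSum_mul hmsq ha hL hk hkK f g

/-- For the data of (1.4): `∫ e^{⟨A′,f⟩} Π_j dμ_{C^{(j),L^jη}}(A′_j) = e^{½⟨f, G_k f⟩}` — `A′ = Data14.fluctSum` is the centred Gaussian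
field with covariance `G_k`, `1 ≤ k ≤ K`. [cite: Balaban1983Higgs3, §1 p.414] -/
theorem data14_integral_exp_fluctSum_pair {N k : ℕ} (D : Data14 P N k) (hmsq : 0 < D.msq) (ha : 0 < D.a)
    (hL : 1 < (P.L : ℝ)) (hk : 1 ≤ k) (hkK : k ≤ P.K) (f : HiggsLattice.VecField P 0) :
    ∫ F, Real.exp (siteInner (toSite (D.fluctSum F)) (toSite f)) ∂(fluctFamily P D.msq D.a k)
      = Real.exp ((1 / 2) * siteInner (toSite f) (vecG P D.msq D.a k (toSite f))) :=
  integral_exp_pair_fluctSum hmsq ha hL hk hkK f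

end FieldCovariance

end Literature.MathematicalPhysics.QuantumFieldTheory.Balaban1983to89.B3FluctFieldCovariance
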